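import Summits.ResolutionOfSingularities.ResolutionOfSingularities.Theorems.FrobeniusLadderFInjectiveMacaulayficationPuncturedFullOfPrimes
import Mathlib.RingTheory.GradedAlgebra.Basic
import Mathlib.Algebra.DirectSum.Decomposition
import HarnessLib

/-!
# The associated graded ring `G(F)` of a multiplicative filtration is an `ℕ`-GRADED RING (Hashimoto bridge (β), part 1)
# (crux `FInjectiveMacaulayfication` stmt-ResolutionOfSingularities-15315, chain w45a, THEOREM-D programme (A1); res-L1-w45a-plan-1 R16.20 «stub-2:
# bridge `cmfiCl_of_vertex_of_hashimoto`»; objects = res-L1-w45a-idea-1's `GDD.MultFiltration / extRees / assocGraded / homogBar` (tree `…GDDDefs`);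
# seat res-L1-w45a-stub-2)

[OURS · L1 W4.5a] Support file (`--supports stmt-ResolutionOfSingularities-15315 --as helper`); NOT a statement of any manuscript; DEFINITIONS (the graded
pieces of `G(F)` and its `GradedRing` structure, as a `def`, no instance) + their API; unconditional; AI-written (AI review is weaker than expert review).

CONTENT. `G(F) = 𝓡(F)/(T⁻¹)` with `𝓡(F) = R[I_n Tⁿ, T⁻¹] ⊆ R[T;T⁻¹]` (tree `GDD.extRees`, `GDD.assocGraded`). §1 coefficients: `f ∈ 𝓡(F) ⇒ coeff_n f ∈ I_n`
for `n ≥ 0` (`coeff_mem_of_mem_extRees`, adjoin induction; the negative-degree coefficients are free and the antitone axiom absorbs them in products);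
every monomial of an element of `𝓡(F)` lies in `𝓡(F)`; `ā·Tⁿ = 0` in `G(F)` for `a ∈ I_{n+1}`. §2 the graded pieces `gradedPiece F n = {ā·Tⁿ : a ∈ I_n}`
(an additive subgroup of `G(F)`), `1 ∈ G₀`, `G_m · G_n ⊆ G_{m+n}` (`SetLike.GradedMonoid`). §3 `G(F) = ⊕ₙ Gₙ` (`DirectSum.IsInternal`: surjective by the
monomial decomposition, injective by comparing coefficients of `T⁻¹·h`), whence `gradedRing F : GradedRing (gradedPiece F)` (a `def`; use with `letI`).
[folklore: Eisenbud, Commutative Algebra §5.1; Bruns–Herzog §4.5]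
-/

-- single-problem summit: the doubled namespace component is forced
set_option linter.dupNamespace false
-- the quotient-of-subalgebra cone `assocGraded F` makes instance synthesis slow (as in `…PuncturedFullOfPrimes`); generous budgets, no change of meaning
set_option synthInstance.maxHeartbeats 400000
set_option maxHeartbeats 1600000

noncomputable section

namespace Summit.ResolutionOfSingularities.ResolutionOfSingularities.Theorems.FInjectiveMacaulayfication.AssocGradedGrading

open Summit.ResolutionOfSingularities.ResolutionOfSingularities.Theorems.FInjectiveMacaulayfication
open GDD LaurentPolynomial

variable {R : Type} [CommRing R] (F : MultFiltration R)

/-! ## §1 Coefficients of elements of the extended Rees algebra -/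

/-- `a·Tᴺ` is the monomial `single N a`. [plumbing] -/
theorem coe_homog (N : ℕ) (a : R) (ha : a ∈ F.I N) :
    (homog F N a ha : LaurentPolynomial R) = AddMonoidAlgebra.single (N : ℤ) a :=
  (single_eq_C_mul_T a (N : ℤ)).symm

/-- `T⁻¹` is the monomial `single (-1) 1`. [plumbing] -/
theorem coe_sInv : (sInv F : LaurentPolynomial R) = T (-1) := rfl

/-- `I_m ⊆ I_n` for `n ≤ m`. [plumbing] -/
theorem I_le_of_le {m n : ℕ} (h : n ≤ m) : F.I m ≤ F.I n := F.antitone h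

/-- **LEMMA A.** The non-negative coefficients of an element of `𝓡(F) = R[I_n Tⁿ, T⁻¹]` lie in the filtration: `coeff_n f ∈ I_n` (`n ≥ 0`).
[folklore] -/
theorem coeff_mem_of_mem_extRees {f : LaurentPolynomial R} (hf : f ∈ extRees F) (n : ℕ) : f.coeff (n : ℤ) ∈ F.I n := by
  classical
  induction hf using Algebra.adjoin_induction generalizing n with
  | mem x hx =>
    rcases hx with hx | hx
    · rw [Set.mem_singleton_iff] at hx
      subst hx
      simp only [T, AddMonoidAlgebra.coeff_single, Finsupp.single_apply]
      rw [if_neg (by omega)]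
      exact (F.I n).zero_mem
    · obtain ⟨m, hm⟩ := Set.mem_iUnion.mp hx
      obtain ⟨a, ha, rfl⟩ := hm
      change (C a * T (m : ℤ)).coeff (n : ℤ) ∈ F.I n
      rw [← single_eq_C_mul_T, AddMonoidAlgebra.coeff_single, Finsupp.single_apply]
      split_ifs with h
      · have : m = n := by exact_mod_cast h
        subst this
        exact ha
      · exact (F.I n).zero_mem
  | algebraMap r =>
    rw [LaurentPolynomial.algebraMap_apply, Algebra.algebraMap_self, RingHom.id_apply, ← single_eq_C,
      AddMonoidAlgebra.coeff_single, Finsupp.single_apply]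
    split_ifs with h
    · have : n = 0 := by exact_mod_cast h.symm
      subst this
      rw [F.I_zero]
      trivial
    · exact (F.I n).zero_mem
  | add x y _ _ hx hy =>
    rw [AddMonoidAlgebra.coeff_add, Finsupp.add_apply]
    exact (F.I n).add_mem (hx n) (hy n)
  | mul x y _ _ hx hy =>
    rw [AddMonoidAlgebra.coeff_mul_apply_left]
    apply Submodule.finsuppSum_mem
    intro i _
    -- the term `x_i · y_{n-i}`
    rcases le_or_gt 0 i with hi | hi
    · rcases le_or_gt 0 (-i + (n : ℤ)) with hj | hj
      · -- both degrees non-negative: `I_i · I_j ⊆ I_{i+j}`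
        have hx' := hx i.toNat
        have hy' := hy (-i + (n : ℤ)).toNat
        rw [Int.toNat_of_nonneg hi] at hx'
        rw [Int.toNat_of_nonneg hj] at hy'
        have hsum : i.toNat + (-i + (n : ℤ)).toNat = n := by omega
        have hmul := F.mul_le _ _ (Ideal.mul_mem_mul hx' hy')
        rwa [hsum] at hmul
      · -- `j < 0`: then `i > n` and `x_i ∈ I_i ⊆ I_n`
        have hx' := hx i.toNat
        rw [Int.toNat_of_nonneg hi] at hx'
        have hle : n ≤ i.toNat := by omega
        exact Ideal.mul_mem_right _ _ (I_le_of_le F hle hx')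
    · -- `i < 0`: then `j > n` and `y_j ∈ I_j ⊆ I_n`
      have hj : 0 ≤ -i + (n : ℤ) := by omega
      have hy' := hy (-i + (n : ℤ)).toNat
      rw [Int.toNat_of_nonneg hj] at hy'
      have hle : n ≤ (-i + (n : ℤ)).toNat := by omega
      exact Ideal.mul_mem_left _ _ (I_le_of_le F hle hy')

/-- The non-negative coefficients of an element of `𝓡(F)`, as members of the filtration (subtype form). [plumbing] -/
theorem coeff_val_mem (f : extRees F) (n : ℕ) : (f : LaurentPolynomial R).coeff (n : ℤ) ∈ F.I n :=
  coeff_mem_of_mem_extRees F f.2 n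

/-- `T⁻ᵏ ∈ 𝓡(F)`. [plumbing] -/
theorem T_neg_mem (k : ℕ) : (T (-(k : ℤ)) : LaurentPolynomial R) ∈ extRees F := by
  have h : (T (-(k : ℤ)) : LaurentPolynomial R) = T (-1) ^ k := by
    rw [T_pow]; congr 1; ring
  rw [h]
  exact Subalgebra.pow_mem _ (T_neg_one_mem F) k

/-- `C c ∈ 𝓡(F)`. [plumbing] -/
theorem C_mem (c : R) : (C c : LaurentPolynomial R) ∈ extRees F := by
  have h : (C c : LaurentPolynomial R) = algebraMap R (LaurentPolynomial R) c := by
    rw [LaurentPolynomial.algebraMap_apply, Algebra.algebraMap_self, RingHom.id_apply]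
  rw [h]
  exact Subalgebra.algebraMap_mem _ c

/-- A monomial of negative degree lies in `𝓡(F)`. [plumbing] -/
theorem single_neg_mem (k : ℕ) (c : R) : (AddMonoidAlgebra.single (-(k : ℤ)) c : LaurentPolynomial R) ∈ extRees F := by
  rw [single_eq_C_mul_T]
  exact Subalgebra.mul_mem _ (C_mem F c) (T_neg_mem F k)

/-- Every monomial of an element of `𝓡(F)` lies in `𝓡(F)`. [folklore] -/
theorem single_coeff_mem (f : extRees F) (m : ℤ) :
    (AddMonoidAlgebra.single m ((f : LaurentPolynomial R).coeff m) : LaurentPolynomial R) ∈ extRees F := by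
  rcases le_or_gt 0 m with hm | hm
  · have h := coeff_val_mem F f m.toNat
    rw [Int.toNat_of_nonneg hm] at h
    have := homog_mem F m.toNat _ h
    rwa [← single_eq_C_mul_T, Int.toNat_of_nonneg hm] at this
  · obtain ⟨k, hk⟩ := Int.exists_eq_neg_ofNat (le_of_lt hm)
    rw [hk]
    exact single_neg_mem F k _

/-- **LEMMA B.** `ā·Tⁿ = 0` in `G(F)` for `a ∈ I_{n+1}`: `a·Tⁿ = T⁻¹ · (a·Tⁿ⁺¹)`. [folklore] -/
theorem homogBar_eq_zero_of_mem_succ (n : ℕ) (a : R) (ha : a ∈ F.I (n + 1)) (ha' : a ∈ F.I n) :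
    homogBar F n a ha' = 0 := by
  have h : homog F n a ha' = sInv F * homog F (n + 1) a ha := by
    apply Subtype.ext
    change C a * T ((n : ℕ) : ℤ) = T (-1) * (C a * T (((n + 1 : ℕ) : ℤ)))
    rw [mul_left_comm, ← T_add]
    congr 2
    push_cast
    ring
  unfold homogBar
  rw [Ideal.Quotient.eq_zero_iff_mem, h]
  exact Ideal.mul_mem_right _ _ (Ideal.subset_span rfl)

/-- A monomial of negative degree vanishes in `G(F)`: `c·T⁻ᵏ⁻¹ = T⁻¹ · c·T⁻ᵏ`. [folklore] -/
theorem mk_single_neg_eq_zero (k : ℕ) (c : R) :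
    Ideal.Quotient.mk (Ideal.span {sInv F}) (⟨AddMonoidAlgebra.single (-((k + 1 : ℕ) : ℤ)) c, single_neg_mem F (k + 1) c⟩ : extRees F) = 0 := by
  rw [Ideal.Quotient.eq_zero_iff_mem]
  have h : (⟨AddMonoidAlgebra.single (-((k + 1 : ℕ) : ℤ)) c, single_neg_mem F (k + 1) c⟩ : extRees F) =
      sInv F * ⟨AddMonoidAlgebra.single (-(k : ℤ)) c, single_neg_mem F k c⟩ := by
    apply Subtype.ext
    change AddMonoidAlgebra.single (-((k + 1 : ℕ) : ℤ)) c = T (-1) * AddMonoidAlgebra.single (-(k : ℤ)) c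
    rw [single_eq_C_mul_T, single_eq_C_mul_T, mul_left_comm, ← T_add]
    congr 2
    push_cast
    ring
  rw [h]
  exact Ideal.mul_mem_right _ _ (Ideal.subset_span rfl)

/-! ## §2 The graded pieces `G(F)_n = {ā·Tⁿ : a ∈ I_n}` -/

/-- `ā·Tⁿ` is additive in `a`. [plumbing] -/
theorem homogBar_add (n : ℕ) (a b : R) (ha : a ∈ F.I n) (hb : b ∈ F.I n) :
    homogBar F n (a + b) ((F.I n).add_mem ha hb) = homogBar F n a ha + homogBar F n b hb := by
  unfold homogBar
  rw [← RingHom.map_add]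
  congr 1
  apply Subtype.ext
  change C (a + b) * T ((n : ℕ) : ℤ) = C a * T ((n : ℕ) : ℤ) + C b * T ((n : ℕ) : ℤ)
  rw [RingHom.map_add, add_mul]

/-- `0̄·Tⁿ = 0`. [plumbing] -/
theorem homogBar_zero (n : ℕ) : homogBar F n 0 (F.I n).zero_mem = 0 := by
  unfold homogBar
  rw [← RingHom.map_zero (Ideal.Quotient.mk (Ideal.span {sInv F}))]
  congr 1
  apply Subtype.ext
  change C (0 : R) * T ((n : ℕ) : ℤ) = 0
  rw [RingHom.map_zero, zero_mul]

/-- `ā·Tᵐ · b̄·Tⁿ = (ab)‾·Tᵐ⁺ⁿ`. [plumbing] -/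
theorem homogBar_mul (m n : ℕ) (a b : R) (ha : a ∈ F.I m) (hb : b ∈ F.I n) :
    homogBar F m a ha * homogBar F n b hb = homogBar F (m + n) (a * b) (F.mul_le m n (Ideal.mul_mem_mul ha hb)) := by
  unfold homogBar
  rw [← RingHom.map_mul]
  congr 1
  apply Subtype.ext
  change C a * T ((m : ℕ) : ℤ) * (C b * T ((n : ℕ) : ℤ)) = C (a * b) * T ((m + n : ℕ) : ℤ)
  rw [RingHom.map_mul, Nat.cast_add, T_add]
  ring

/-- The additive map `I_n → G(F)`, `a ↦ ā·Tⁿ`. [OURS plumbing definition] -/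
def homogBarHom (n : ℕ) : F.I n →+ assocGraded F where
  toFun a := homogBar F n a a.2
  map_zero' := homogBar_zero F n
  map_add' a b := homogBar_add F n a b a.2 b.2

/-- The `n`-th GRADED PIECE `G(F)_n = I_n/I_{n+1} = {ā·Tⁿ : a ∈ I_n} ⊆ G(F)` (an additive subgroup). [folklore] -/
def gradedPiece (n : ℕ) : AddSubgroup (assocGraded F) := (homogBarHom F n).range

/-- Membership in a graded piece. [plumbing] -/
theorem mem_gradedPiece_iff {n : ℕ} {x : assocGraded F} :
    x ∈ gradedPiece F n ↔ ∃ (a : R) (ha : a ∈ F.I n), homogBar F n a ha = x :=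
  ⟨fun ⟨a, h⟩ => ⟨a, a.2, h⟩, fun ⟨a, ha, h⟩ => ⟨⟨a, ha⟩, h⟩⟩

/-- `ā·Tⁿ ∈ G(F)_n`. [plumbing] -/
theorem homogBar_mem (n : ℕ) (a : R) (ha : a ∈ F.I n) : homogBar F n a ha ∈ gradedPiece F n := ⟨⟨a, ha⟩, rfl⟩

/-- `1 ∈ G(F)_0`. [folklore] -/
theorem one_mem_gradedPiece : (1 : assocGraded F) ∈ gradedPiece F 0 := by
  rw [← homogBar_zero_one R F]
  exact homogBar_mem F 0 1 _

/-- `G(F)_m · G(F)_n ⊆ G(F)_{m+n}`. [folklore] -/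
theorem mul_mem_gradedPiece {m n : ℕ} {x y : assocGraded F} (hx : x ∈ gradedPiece F m) (hy : y ∈ gradedPiece F n) :
    x * y ∈ gradedPiece F (m + n) := by
  obtain ⟨a, ha, rfl⟩ := (mem_gradedPiece_iff F).mp hx
  obtain ⟨b, hb, rfl⟩ := (mem_gradedPiece_iff F).mp hy
  rw [homogBar_mul]
  exact homogBar_mem F _ _ _

/-! ## §3 `G(F) = ⊕ₙ G(F)_n` -/

/-- An element of `𝓡(F)` is the sum of its monomials (each of which lies in `𝓡(F)`). [folklore] -/
theorem eq_sum_single (f : extRees F) :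
    f = ∑ m ∈ (f : LaurentPolynomial R).coeff.support,
      (⟨AddMonoidAlgebra.single m ((f : LaurentPolynomial R).coeff m), single_coeff_mem F f m⟩ : extRees F) := by
  apply Subtype.ext
  rw [AddSubmonoidClass.coe_finsetSum]
  conv_lhs => rw [← AddMonoidAlgebra.sum_coeff_single (f : LaurentPolynomial R)]
  rfl

/-- A monomial of non-negative degree `m` of an element of `𝓡(F)` maps to `(coeff_m f)‾·Tᵐ ∈ G(F)_m`. [plumbing] -/
theorem mk_single_eq_homogBar (f : extRees F) (m : ℕ) :
    Ideal.Quotient.mk (Ideal.span {sInv F})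
        (⟨AddMonoidAlgebra.single (m : ℤ) ((f : LaurentPolynomial R).coeff m), single_coeff_mem F f m⟩ : extRees F) =
      homogBar F m ((f : LaurentPolynomial R).coeff m) (coeff_val_mem F f m) := by
  unfold homogBar
  congr 1
  apply Subtype.ext
  change AddMonoidAlgebra.single (m : ℤ) _ = C _ * T ((m : ℕ) : ℤ)
  rw [single_eq_C_mul_T]

/-- **`⊕ₙ G(F)_n → G(F)` is surjective**: every element of `G(F)` is a finite sum of homogeneous elements (the images of the non-negative
monomials of a lift; the negative ones vanish). [folklore] -/
theorem coeAddMonoidHom_surjective : Function.Surjective (DirectSum.coeAddMonoidHom (gradedPiece F)) := by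
  classical
  intro g
  obtain ⟨f, rfl⟩ := Ideal.Quotient.mk_surjective g
  suffices h : Ideal.Quotient.mk (Ideal.span {sInv F}) f ∈ (DirectSum.coeAddMonoidHom (gradedPiece F)).range by
    obtain ⟨x, hx⟩ := h
    exact ⟨x, hx⟩
  rw [eq_sum_single F f, map_sum]
  refine AddSubgroup.sum_mem _ fun m _ => ?_
  rcases le_or_gt 0 m with h0 | h0
  · -- non-negative degree: the image is `(coeff_m f)‾·Tᵐ`
    obtain ⟨m', rfl⟩ := Int.eq_ofNat_of_zero_le h0
    rw [mk_single_eq_homogBar F f m']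
    exact ⟨DirectSum.of (fun n => gradedPiece F n) m' ⟨_, homogBar_mem F m' _ _⟩, DirectSum.coeAddMonoidHom_of _ _ _⟩
  · -- negative degree: the image vanishes
    obtain ⟨k, hk⟩ := Int.exists_eq_neg_ofNat (le_of_lt h0)
    obtain ⟨k', rfl⟩ : ∃ k', k = k' + 1 := Nat.exists_eq_succ_of_ne_zero (by omega)
    subst hk
    rw [mk_single_neg_eq_zero F k']
    exact zero_mem _

/-- Coefficient `n` of a finite sum of monomials `∑ₘ aₘ·Tᵐ` (`m ∈ S ⊆ ℕ`) is `aₙ` for `n ∈ S`. [plumbing] -/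
theorem coeff_sum_single (S : Finset ℕ) (a : ℕ → R) (n : ℕ) (hn : n ∈ S) :
    (∑ m ∈ S, (AddMonoidAlgebra.single (m : ℤ) (a m) : LaurentPolynomial R)).coeff (n : ℤ) = a n := by
  classical
  rw [AddMonoidAlgebra.coeff_sum, Finset.sum_apply']
  simp only [AddMonoidAlgebra.coeff_single, Finsupp.single_apply, Nat.cast_inj]
  rw [Finset.sum_ite_eq' S n a, if_pos hn]

/-- **`⊕ₙ G(F)_n → G(F)` is injective**: if `∑ₙ āₙ·Tⁿ = 0` in `G(F)` then `∑ₙ aₙ Tⁿ = T⁻¹·h` with `h ∈ 𝓡(F)`, so `aₙ = coeff_{n+1} h ∈ I_{n+1}`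
and every `āₙ·Tⁿ` is already `0`. [folklore] -/
theorem coeAddMonoidHom_injective : Function.Injective (DirectSum.coeAddMonoidHom (gradedPiece F)) := by
  classical
  rw [injective_iff_map_eq_zero]
  intro x hx
  -- representatives `a n ∈ I_n` with `x n = (a n)‾·Tⁿ`
  have hrep : ∀ n : ℕ, ∃ a : F.I n, homogBar F n a a.2 = (x n : assocGraded F) := fun n => (x n).2
  choose a ha using hrep
  -- the lift `P = ∑_{n ∈ supp x} aₙ Tⁿ ∈ 𝓡(F)` maps to `∑ x n = 0`
  have hsum : (∑ n ∈ x.support, (x n : assocGraded F)) = 0 := by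
    have h := congrArg (DirectSum.coeAddMonoidHom (gradedPiece F)) (DirectSum.sum_support_of x)
    rw [map_sum] at h
    simp only [DirectSum.coeAddMonoidHom_of] at h
    rw [h]
    exact hx
  have hP : (∑ n ∈ x.support, homog F n (a n) (a n).2) ∈ Ideal.span {sInv F} := by
    rw [← Ideal.Quotient.eq_zero_iff_mem, map_sum]
    rw [← hsum]
    exact Finset.sum_congr rfl fun n _ => ha n
  obtain ⟨h, hh⟩ := Ideal.mem_span_singleton'.mp hP
  -- compare the coefficients of `T⁻¹·h = P` in degree `n`
  have hcoeff : ∀ n ∈ x.support, ((a n : R)) = (h : LaurentPolynomial R).coeff ((n + 1 : ℕ) : ℤ) := by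
    intro n hn
    have e := congrArg (fun q : extRees F => (q : LaurentPolynomial R).coeff (n : ℤ)) hh
    simp only [Subalgebra.coe_mul, AddSubmonoidClass.coe_finsetSum, coe_homog, coe_sInv, T,
      AddMonoidAlgebra.coeff_mul_single_apply, mul_one] at e
    rw [coeff_sum_single x.support (fun m => (a m : R)) n hn] at e
    rw [← e]
    congr 1
  -- hence every component vanishes
  refine DFinsupp.ext fun n => ?_
  by_cases hn : n ∈ x.support
  · apply Subtype.ext
    rw [← ha n]
    change homogBar F n (a n) (a n).2 = 0
    have hmem : (a n : R) ∈ F.I (n + 1) := by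
      rw [hcoeff n hn]
      exact coeff_val_mem F h (n + 1)
    exact homogBar_eq_zero_of_mem_succ F n (a n) hmem (a n).2
  · exact DFinsupp.notMem_support_iff.mp hn

/-- `G(F)` is the INTERNAL direct sum of its graded pieces. [folklore] -/
theorem isInternal_gradedPiece : DirectSum.IsInternal (gradedPiece F) :=
  ⟨coeAddMonoidHom_injective F, coeAddMonoidHom_surjective F⟩

/-- **`G(F)` is an `ℕ`-graded ring** with pieces `G(F)_n = I_n/I_{n+1}` (a `def`, to be used with `letI`; the decomposition is the
noncomputable inverse of the bijection `⊕ₙ G(F)_n → G(F)`). [folklore] -/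
@[reducible] def gradedRing : GradedRing (gradedPiece F) :=
  letI : DirectSum.Decomposition (gradedPiece F) := (isInternal_gradedPiece F).chooseDecomposition
  { one_mem := one_mem_gradedPiece F
    mul_mem := fun _ _ _ _ hx hy => mul_mem_gradedPiece F hx hy }

end Summit.ResolutionOfSingularities.ResolutionOfSingularities.Theorems.FInjectiveMacaulayfication.AssocGradedGrading

end
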